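import Mathlib
import Literature.NumberTheory.LFunctions.Zhang2022.Section17NuOneStarExpansion
import Literature.NumberTheory.LFunctions.Zhang2022.Section17SummedError
import HarnessLib

/-!
# Zhang (2022) §17.u025 is a THEOREM: "the right side [of u024] is equal to
# `𝔢₁Σ_{l<D⁴}ν(l)²/l + o(1) = 𝔢₁𝔞 + o(1)`" — the first equality PROVED, the second Lemma 17.1

Topic `Literature/NumberTheory/LFunctions/Zhang2022` (Landau–Siegel audit tree; verdict-neutral).
Y. Zhang, *Discrete mean estimates and the Landau–Siegel zero*, arXiv:2211.02515v1 (2022)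
[Zhang2022LandauSiegel] — **an unrefereed manuscript under adjudication**; nothing here asserts or
denies its Theorems 1–2. §17 p. 98 (tex L4838–L4844; DAG `Z22:§17.u025`, typed as
`Typed.Section17.Step17_u025 c′`). The tree's kernel edge `Phi3Eval.step17_u025_of`
(`Section17InnerEdges`) reduces the node to its FIRST printed equality `hW`,
`‖𝔢₁·Σ_{l<D⁴}(ν(l)/l)Σ_{l=l₁l₂}χ(l₁)τ₂(l₁)ν₁*(l₂) − 𝔢₁·Σ_{l<D⁴}ν(l)²/l‖ ≤ ε` for large `D` ("in a way
similar to the proof of (17.5)", not carried out in print); the second equality is Lemma 17.1, the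
tree theorem `appBLemma171_holds`. THIS FILE PROVES `hW` (`step17_hW_holds`) and hence the node
outright (`step17_u025_holds : ∀ c′, Step17_u025 c′`), with NO input on `𝔞` and no use of (A):
by `Phi3Eval.inner17_u025_eq` (`Section17NuOneStarExpansion`) the inner sum is EXACTLY
`ν(l) + (χ∗η₂)(l) + (χ∗η₃)(l) + (χ∗μ∗η₂∗η₃)(l)` for `l ≤ D⁴`, where `η_j = nN_{β_j} − 1` has
`|η_j| ≤ δ = 21α𝓛` on `[1, D⁴]` (`Phi3Eval.norm_nN_sub_one_le`, `Section17SummedError`); so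
`|inner(l) − ν(l)| ≤ 2δτ₂(l) + δ²τ₄(l)`, and against the weights `|ν(l)|/l` the Euler-product counts
(Hall–Tenenbaum + Mertens, the tree's `MeanSquareMajorant.sum_div_le`; `|ν|τ₂` has prime value
`|1+χ(p)|·2 ≤ 4`, `|ν|τ₄` has `≤ 8`) give `|𝔢₁|(2δ·M(4𝓛)⁴ + δ²·M′(4𝓛)⁸) ≤ |𝔢₁|(42π4⁴M + 441π²4⁸M′)𝓛⁻⁴`.

* `norm_chiAF_mul_toAF_apply_le` (`|(χ∗η)(l)| ≤ δτ₂(l)`), `norm_chiAF_mul_moebius_apply_le`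
  (`|(χ∗μ)(n)| ≤ τ₂(n)`), `norm_chi_moebius_mul_mul_apply_le` (`|(χ∗μ∗η₂∗η₃)(l)| ≤ δ²τ₄(l)`);
* `sum_normNu_tau_two_div_le`, `sum_normNu_tau_four_div_le` — the two counts;
* `step17_hW_holds` — the hypothesis `hW` of `step17_u025_of`; **`step17_u025_holds`** — the node.

Theorems only (no definitions, no named facts); axioms standard. WHAT THIS IS NOT: any claim about
u024, (17.8), (17.9), Theorems 1–2 of the source or Landau–Siegel zeros; nothing here bears on the
cell's verdict on (8.24).

## References

* Y. Zhang, arXiv:2211.02515v1 (2022), §17 p. 98 (u025), p. 96 ((17.5), Lemma 17.1); §3 p. 6.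
  [cite: Zhang2022LandauSiegel, §17 u025 p.98]
* R. R. Hall, G. Tenenbaum, *Divisors*, CUP 1988, (0.4). [cite: HallTenenbaum1988, (0.4)]
-/

noncomputable section

open Complex Real Finset ArithmeticFunction
open Literature.NumberTheory.LFunctions.Zhang2022.Skeleton
open Literature.NumberTheory.LFunctions.Zhang2022.Typed.Section17
open Literature.NumberTheory.LFunctions.Zhang2022.MeanSquareMajorant

namespace Literature.NumberTheory.LFunctions.Zhang2022.Phi3Eval

/-! ## §2. The bounds and the node `Step17_u025` -/

section Assembly

variable {D : ℕ} (χ : DirichletCharacter ℂ D)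

/-- `|(χ ∗ η)(l)| ≤ δ·τ₂(l)` when `|η(n)| ≤ δ` for `1 ≤ n ≤ l`. [cite: Zhang2022LandauSiegel, §17 u025 p.98] -/
theorem norm_chiAF_mul_toAF_apply_le {η : ℕ → ℂ} {δ : ℝ} {l : ℕ}
    (hη : ∀ n : ℕ, n ≠ 0 → n ≤ l → ‖η n‖ ≤ δ) :
    ‖(toArithmeticFunction (fun k : ℕ => χ (k : ZMod D)) * toArithmeticFunction η) l‖ ≤
      δ * tau 2 l := by
  rw [mul_apply]
  calc ‖∑ q ∈ l.divisorsAntidiagonal, toArithmeticFunction (fun k : ℕ => χ (k : ZMod D)) q.1 *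
          toArithmeticFunction η q.2‖
      ≤ ∑ q ∈ l.divisorsAntidiagonal, ‖toArithmeticFunction (fun k : ℕ => χ (k : ZMod D)) q.1 *
          toArithmeticFunction η q.2‖ := norm_sum_le _ _
    _ ≤ ∑ _q ∈ l.divisorsAntidiagonal, δ := Finset.sum_le_sum fun q hq => by
        obtain ⟨hq1, hq2, -, hq2le⟩ := bounds_of_mem_antidiag hq
        rw [norm_mul]
        simp only [toArithmeticFunction, ArithmeticFunction.coe_mk, hq1, hq2, if_false]
        calc ‖χ (q.1 : ZMod D)‖ * ‖η q.2‖ ≤ 1 * δ :=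
              mul_le_mul (χ.norm_le_one _) (hη q.2 hq2 hq2le) (norm_nonneg _) zero_le_one
          _ = δ := one_mul _
    _ = δ * tau 2 l := by
        rw [← card_antidiag_eq_tau_two, Finset.mul_sum]
        simp

/-- `|(χ ∗ μ)(n)| ≤ τ₂(n)`. [cite: Zhang2022LandauSiegel, §3 p.6] -/
theorem norm_chiAF_mul_moebius_apply_le (n : ℕ) :
    ‖(toArithmeticFunction (fun k : ℕ => χ (k : ZMod D)) *
      (ArithmeticFunction.moebius : ArithmeticFunction ℂ)) n‖ ≤ tau 2 n := by
  rw [mul_apply]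
  calc ‖∑ q ∈ n.divisorsAntidiagonal, toArithmeticFunction (fun k : ℕ => χ (k : ZMod D)) q.1 *
          (ArithmeticFunction.moebius : ArithmeticFunction ℂ) q.2‖
      ≤ ∑ q ∈ n.divisorsAntidiagonal, ‖toArithmeticFunction (fun k : ℕ => χ (k : ZMod D)) q.1 *
          (ArithmeticFunction.moebius : ArithmeticFunction ℂ) q.2‖ := norm_sum_le _ _
    _ ≤ ∑ _q ∈ n.divisorsAntidiagonal, (1 : ℝ) := Finset.sum_le_sum fun q hq => by
        obtain ⟨hq1, -, -, -⟩ := bounds_of_mem_antidiag hq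
        rw [norm_mul, intCoe_apply]
        simp only [toArithmeticFunction, ArithmeticFunction.coe_mk, hq1, if_false]
        have hμ : ‖((ArithmeticFunction.moebius q.2 : ℤ) : ℂ)‖ ≤ 1 := by
          rw [Complex.norm_intCast]; exact_mod_cast ArithmeticFunction.abs_moebius_le_one
        calc ‖χ (q.1 : ZMod D)‖ * ‖((ArithmeticFunction.moebius q.2 : ℤ) : ℂ)‖ ≤ 1 * 1 :=
              mul_le_mul (χ.norm_le_one _) hμ (norm_nonneg _) zero_le_one
          _ = 1 := one_mul _
    _ = tau 2 n := card_antidiag_eq_tau_two n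

/-- `|(χ ∗ μ ∗ η₂ ∗ η₃)(l)| ≤ δ²·τ₄(l)` when `|η_j(n)| ≤ δ` for `1 ≤ n ≤ l`.
[cite: Zhang2022LandauSiegel, §17 u025 p.98] -/
theorem norm_chi_moebius_mul_mul_apply_le {η₂ η₃ : ℕ → ℂ} {δ : ℝ} (hδ : 0 ≤ δ) {l : ℕ}
    (h₂ : ∀ n : ℕ, n ≠ 0 → n ≤ l → ‖η₂ n‖ ≤ δ) (h₃ : ∀ n : ℕ, n ≠ 0 → n ≤ l → ‖η₃ n‖ ≤ δ) :
    ‖(toArithmeticFunction (fun k : ℕ => χ (k : ZMod D)) *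
        (ArithmeticFunction.moebius : ArithmeticFunction ℂ) *
        toArithmeticFunction η₂ * toArithmeticFunction η₃) l‖ ≤ δ ^ 2 * tau 4 l := by
  set XM : ArithmeticFunction ℂ := toArithmeticFunction (fun k : ℕ => χ (k : ZMod D)) *
    (ArithmeticFunction.moebius : ArithmeticFunction ℂ) with hXM
  have hexp : (XM * toArithmeticFunction η₂ * toArithmeticFunction η₃) l =
      ∑ x ∈ l.divisorsAntidiagonal, ∑ y ∈ x.1.divisorsAntidiagonal, XM y.1 * η₂ y.2 * η₃ x.2 := by
    rw [mul_apply]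
    refine Finset.sum_congr rfl fun x hx => ?_
    obtain ⟨-, hx2, -, -⟩ := bounds_of_mem_antidiag hx
    rw [mul_apply, Finset.sum_mul]
    refine Finset.sum_congr rfl fun y hy => ?_
    obtain ⟨-, hy2, -, -⟩ := bounds_of_mem_antidiag hy
    simp [toArithmeticFunction, hy2, hx2]
  rw [hexp]
  calc ‖∑ x ∈ l.divisorsAntidiagonal, ∑ y ∈ x.1.divisorsAntidiagonal, XM y.1 * η₂ y.2 * η₃ x.2‖
      ≤ ∑ x ∈ l.divisorsAntidiagonal, ∑ y ∈ x.1.divisorsAntidiagonal, tau 2 y.1 * (δ * δ) := by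
        refine (norm_sum_le _ _).trans (Finset.sum_le_sum fun x hx => ?_)
        obtain ⟨-, hx2, hx1le, hx2le⟩ := bounds_of_mem_antidiag hx
        refine (norm_sum_le _ _).trans (Finset.sum_le_sum fun y hy => ?_)
        obtain ⟨-, hy2, -, hy2le⟩ := bounds_of_mem_antidiag hy
        rw [norm_mul, norm_mul, mul_assoc]
        exact mul_le_mul (norm_chiAF_mul_moebius_apply_le χ y.1)
          (mul_le_mul (h₂ y.2 hy2 (hy2le.trans hx1le)) (h₃ x.2 hx2 hx2le) (norm_nonneg _) hδ)
          (mul_nonneg (norm_nonneg _) (norm_nonneg _)) (tau_nonneg _ _)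
    _ = δ ^ 2 * tau 4 l := by
        rw [← sum_sum_tau_two_eq', Finset.mul_sum]
        refine Finset.sum_congr rfl fun x _ => ?_
        rw [Finset.mul_sum]
        exact Finset.sum_congr rfl fun y _ => by ring

/-- The count of `|ν|·τ_j`: prime value `≤ 2j`; for `j = 2`: `Σ_{n≤X} |ν(n)|τ₂(n)/n ≤ M·(log X)⁴`.
[cite: HallTenenbaum1988, (0.4)] -/
theorem sum_normNu_tau_two_div_le (hχ : χ.IsQuadratic) {X : ℕ} (hX : 2 ≤ X) :
    ∑ n ∈ Icc 1 X, ((normAF ((ArithmeticFunction.zeta : ArithmeticFunction ℂ) *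
        toArithmeticFunction (fun n : ℕ => χ (n : ZMod D)))).pmul (tau 2)) n / n ≤
      majorantConst 4 4 * Real.log X ^ 4 := by
  have hB := isBlock_pmul (isBlock_normAF_nu χ) (isBlock_tau 2)
  have h := sum_div_le (f := fun n => ((normAF ((ArithmeticFunction.zeta : ArithmeticFunction ℂ) *
        toArithmeticFunction (fun n : ℕ => χ (n : ZMod D)))).pmul (tau 2)) n)
    (a := 4) (d := 4) (K := 0) hB.isMult.map_one (fun m n hmn => hB.isMult.map_mul_of_coprime hmn)
    hB.nonneg le_rfl ?_ (fun p ν hp => hB.pow_le p ν hp) hX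
  · simpa only [zero_mul, Real.exp_zero, mul_one] using h
  · intro p hp
    rw [pmul_apply, normAF_nu_prime χ hp, tau_prime 2 hp, zero_mul, add_zero]
    push_cast
    nlinarith [norm_one_add_chi_le_two χ hχ p, norm_nonneg (1 + χ (p : ZMod D))]

/-- For `j = 4`: `Σ_{n≤X} |ν(n)|τ₄(n)/n ≤ M'·(log X)⁸`. [cite: HallTenenbaum1988, (0.4)] -/
theorem sum_normNu_tau_four_div_le (hχ : χ.IsQuadratic) {X : ℕ} (hX : 2 ≤ X) :
    ∑ n ∈ Icc 1 X, ((normAF ((ArithmeticFunction.zeta : ArithmeticFunction ℂ) *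
        toArithmeticFunction (fun n : ℕ => χ (n : ZMod D)))).pmul (tau 4)) n / n ≤
      majorantConst 8 6 * Real.log X ^ 8 := by
  have hB := isBlock_pmul (isBlock_normAF_nu χ) (isBlock_tau 4)
  have h := sum_div_le (f := fun n => ((normAF ((ArithmeticFunction.zeta : ArithmeticFunction ℂ) *
        toArithmeticFunction (fun n : ℕ => χ (n : ZMod D)))).pmul (tau 4)) n)
    (a := 8) (d := 6) (K := 0) hB.isMult.map_one (fun m n hmn => hB.isMult.map_mul_of_coprime hmn)
    hB.nonneg le_rfl ?_ (fun p ν hp => hB.pow_le p ν hp) hX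
  · simpa only [zero_mul, Real.exp_zero, mul_one] using h
  · intro p hp
    rw [pmul_apply, normAF_nu_prime χ hp, tau_prime 4 hp, zero_mul, add_zero]
    push_cast
    nlinarith [norm_one_add_chi_le_two χ hχ p, norm_nonneg (1 + χ (p : ZMod D))]

/-- **The first equality of §17.u025 (hypothesis `hW` of `step17_u025_of`), PROVED**: for every `c′`
and `ε > 0`, for all large `D`, `‖𝔢₁·Σ_{l<D⁴}(ν(l)/l)Σ_{l=l₁l₂}χ(l₁)τ₂(l₁)ν₁*(l₂) − 𝔢₁·Σ_{l<D⁴}ν(l)²/l‖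
≤ ε` — indeed `≤ |𝔢₁|(42π·4⁴M + 441π²·4⁸M′)𝓛⁻⁴`. No input on `𝔞`, no use of (A).
[cite: Zhang2022LandauSiegel, §17 u025 p.98] -/
theorem step17_hW_holds (c' : ℝ) : ∀ ε : ℝ, 0 < ε → ForAllLarge fun D _ χ => AssumptionA D χ →
      ‖frake 1 * (∑ l ∈ Finset.Ico 1 (D ^ 4), nu χ l / (l : ℂ) *
          ∑ q ∈ l.divisorsAntidiagonal,
            χ (q.1 : ZMod D) * (q.1.divisors.card : ℂ) * nuOneStar c' χ q.2) -
        frake 1 * ∑ l ∈ Finset.Ico 1 (D ^ 4), nu χ l ^ 2 / (l : ℂ)‖ ≤ ε := by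
  intro ε hε
  set K : ℝ := ‖frake 1‖ *
    (42 * Real.pi * 4 ^ 4 * majorantConst 4 4 + 441 * Real.pi ^ 2 * 4 ^ 8 * majorantConst 8 6) with hK
  obtain ⟨D₀, hD₀⟩ := hE_thresholds c' K ε hε
  refine ⟨D₀, fun D _ χ hD hq _ _ => ?_⟩
  obtain ⟨hℓ3, hc, hT, hsmall, hKε⟩ := hD₀ D hD
  have hℓ1 : 1 ≤ ell D := by linarith
  have hℓ0 : 0 < ell D := by linarith
  have hπ := Real.pi_pos
  have hα0 : 0 < alpha D := alpha_pos' hℓ0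
  have hα : alpha D = Real.pi / ell D ^ 9 := by rw [alpha, bigP, Real.log_exp]
  have hαℓ : alpha D * ell D = Real.pi / ell D ^ 8 := by rw [hα]; field_simp
  -- `δ = 21α𝓛`
  set δ : ℝ := 21 * (alpha D * ell D) with hδ
  have hδ0 : 0 ≤ δ := by positivity
  have hβ2 : ‖beta2 c' D‖ ≤ 5 * alpha D :=
    (ResidueValues.norm_beta2_le c' hℓ3 hc).trans (by linarith)
  have hβ3 : ‖beta3 c' D‖ ≤ 5 * alpha D :=
    (ResidueValues.norm_beta3_le c' hℓ3 hc).trans (by linarith)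
  have hβ2re : (beta2 c' D).re = 0 := by simp [beta2]
  have hβ3re : (beta3 c' D).re = 0 := by simp [beta3]
  have hη₂ : ∀ n : ℕ, n ≠ 0 → n ≤ D ^ 4 → ‖nN D (beta2 c' D) n - 1‖ ≤ δ := fun n hn hnD =>
    norm_nN_sub_one_le hℓ1 hT hsmall hβ2re hβ2 hn hnD
  have hη₃ : ∀ n : ℕ, n ≠ 0 → n ≤ D ^ 4 → ‖nN D (beta3 c' D) n - 1‖ ≤ δ := fun n hn hnD =>
    norm_nN_sub_one_le hℓ1 hT hsmall hβ3re hβ3 hn hnD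
  -- `D ≥ 2`, `log D⁴ = 4𝓛`
  have hD2 : 2 ≤ D := by
    by_contra h
    have hD1 : (D : ℝ) ≤ 1 := by exact_mod_cast (by omega : D ≤ 1)
    have : ell D ≤ 0 := Real.log_nonpos (Nat.cast_nonneg D) hD1
    linarith
  have hX2 : 2 ≤ D ^ 4 := le_trans hD2 (Nat.le_self_pow (by norm_num) D)
  have hlogX : Real.log ((D ^ 4 : ℕ) : ℝ) = 4 * ell D := by
    push_cast; rw [Real.log_pow]; push_cast; rfl
  -- abbreviations
  set G₁ : ℕ → ℝ := fun l => ((normAF ((ArithmeticFunction.zeta : ArithmeticFunction ℂ) *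
        toArithmeticFunction (fun n : ℕ => χ (n : ZMod D)))).pmul (tau 2)) l with hG₁
  set G₂ : ℕ → ℝ := fun l => ((normAF ((ArithmeticFunction.zeta : ArithmeticFunction ℂ) *
        toArithmeticFunction (fun n : ℕ => χ (n : ZMod D)))).pmul (tau 4)) l with hG₂
  have hG₁0 : ∀ l, 0 ≤ G₁ l := fun l => (isBlock_pmul (isBlock_normAF_nu χ) (isBlock_tau 2)).nonneg l
  have hG₂0 : ∀ l, 0 ≤ G₂ l := fun l => (isBlock_pmul (isBlock_normAF_nu χ) (isBlock_tau 4)).nonneg l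
  have hG₁e : ∀ l, G₁ l = ‖nu χ l‖ * tau 2 l := fun l => by
    simp only [hG₁, pmul_apply, normAF_apply, nuAF_apply]
  have hG₂e : ∀ l, G₂ l = ‖nu χ l‖ * tau 4 l := fun l => by
    simp only [hG₂, pmul_apply, normAF_apply, nuAF_apply]
  -- the inner sums, pointwise
  set W : ℕ → ℂ := fun l => ∑ q ∈ l.divisorsAntidiagonal,
    χ (q.1 : ZMod D) * (q.1.divisors.card : ℂ) * nuOneStar c' χ q.2 with hW
  have hR : ∀ l ∈ Finset.Ico 1 (D ^ 4), ‖W l - nu χ l‖ ≤ 2 * δ * tau 2 l + δ ^ 2 * tau 4 l := by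
    intro l hl
    have hl4 : l ≤ D ^ 4 := (Finset.mem_Ico.1 hl).2.le
    have h₂' : ∀ n : ℕ, n ≠ 0 → n ≤ l → ‖nN D (beta2 c' D) n - 1‖ ≤ δ := fun n hn hnl =>
      hη₂ n hn (hnl.trans hl4)
    have h₃' : ∀ n : ℕ, n ≠ 0 → n ≤ l → ‖nN D (beta3 c' D) n - 1‖ ≤ δ := fun n hn hnl =>
      hη₃ n hn (hnl.trans hl4)
    rw [hW]
    simp only
    rw [inner17_u025_eq c' χ hl4]
    have e : nu χ l +
        (toArithmeticFunction (fun k : ℕ => χ (k : ZMod D)) *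
          toArithmeticFunction (fun n : ℕ => nN D (beta2 c' D) n - 1)) l +
        (toArithmeticFunction (fun k : ℕ => χ (k : ZMod D)) *
          toArithmeticFunction (fun n : ℕ => nN D (beta3 c' D) n - 1)) l +
        (toArithmeticFunction (fun k : ℕ => χ (k : ZMod D)) *
          (ArithmeticFunction.moebius : ArithmeticFunction ℂ) *
          toArithmeticFunction (fun n : ℕ => nN D (beta2 c' D) n - 1) *
          toArithmeticFunction (fun n : ℕ => nN D (beta3 c' D) n - 1)) l - nu χ l =
        (toArithmeticFunction (fun k : ℕ => χ (k : ZMod D)) *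
          toArithmeticFunction (fun n : ℕ => nN D (beta2 c' D) n - 1)) l +
        (toArithmeticFunction (fun k : ℕ => χ (k : ZMod D)) *
          toArithmeticFunction (fun n : ℕ => nN D (beta3 c' D) n - 1)) l +
        (toArithmeticFunction (fun k : ℕ => χ (k : ZMod D)) *
          (ArithmeticFunction.moebius : ArithmeticFunction ℂ) *
          toArithmeticFunction (fun n : ℕ => nN D (beta2 c' D) n - 1) *
          toArithmeticFunction (fun n : ℕ => nN D (beta3 c' D) n - 1)) l := by ring
    rw [e]
    calc _ ≤ ‖(toArithmeticFunction (fun k : ℕ => χ (k : ZMod D)) *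
            toArithmeticFunction (fun n : ℕ => nN D (beta2 c' D) n - 1)) l‖ +
          ‖(toArithmeticFunction (fun k : ℕ => χ (k : ZMod D)) *
            toArithmeticFunction (fun n : ℕ => nN D (beta3 c' D) n - 1)) l‖ +
          ‖(toArithmeticFunction (fun k : ℕ => χ (k : ZMod D)) *
            (ArithmeticFunction.moebius : ArithmeticFunction ℂ) *
            toArithmeticFunction (fun n : ℕ => nN D (beta2 c' D) n - 1) *
            toArithmeticFunction (fun n : ℕ => nN D (beta3 c' D) n - 1)) l‖ :=
          (norm_add_le _ _).trans (add_le_add (norm_add_le _ _) le_rfl)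
      _ ≤ δ * tau 2 l + δ * tau 2 l + δ ^ 2 * tau 4 l :=
          add_le_add (add_le_add (norm_chiAF_mul_toAF_apply_le χ h₂')
            (norm_chiAF_mul_toAF_apply_le χ h₃')) (norm_chi_moebius_mul_mul_apply_le χ hδ0 h₂' h₃')
      _ = 2 * δ * tau 2 l + δ ^ 2 * tau 4 l := by ring
  -- the difference as `𝔢₁·Σ_l (ν(l)/l)(W(l) − ν(l))`
  have hdiff : frake 1 * (∑ l ∈ Finset.Ico 1 (D ^ 4), nu χ l / (l : ℂ) * W l) -
      frake 1 * ∑ l ∈ Finset.Ico 1 (D ^ 4), nu χ l ^ 2 / (l : ℂ) =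
      frake 1 * ∑ l ∈ Finset.Ico 1 (D ^ 4), nu χ l / (l : ℂ) * (W l - nu χ l) := by
    rw [← mul_sub, ← Finset.sum_sub_distrib]
    congr 1
    exact Finset.sum_congr rfl fun l _ => by ring
  have hsumR : ∑ l ∈ Finset.Ico 1 (D ^ 4), ‖nu χ l‖ / l * (2 * δ * tau 2 l + δ ^ 2 * tau 4 l) ≤
      2 * δ * (majorantConst 4 4 * (4 * ell D) ^ 4) + δ ^ 2 * (majorantConst 8 6 * (4 * ell D) ^ 8) := by
    have h1 := sum_normNu_tau_two_div_le χ hq hX2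
    have h2 := sum_normNu_tau_four_div_le χ hq hX2
    rw [hlogX] at h1 h2
    calc ∑ l ∈ Finset.Ico 1 (D ^ 4), ‖nu χ l‖ / l * (2 * δ * tau 2 l + δ ^ 2 * tau 4 l)
        = ∑ l ∈ Finset.Ico 1 (D ^ 4), (2 * δ * (G₁ l / l) + δ ^ 2 * (G₂ l / l)) :=
          Finset.sum_congr rfl fun l _ => by rw [hG₁e, hG₂e]; ring
      _ ≤ ∑ l ∈ Finset.Icc 1 (D ^ 4), (2 * δ * (G₁ l / l) + δ ^ 2 * (G₂ l / l)) :=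
          Finset.sum_le_sum_of_subset_of_nonneg Finset.Ico_subset_Icc_self fun l _ _ =>
            add_nonneg (mul_nonneg (by positivity) (div_nonneg (hG₁0 l) (Nat.cast_nonneg l)))
              (mul_nonneg (by positivity) (div_nonneg (hG₂0 l) (Nat.cast_nonneg l)))
      _ = 2 * δ * (∑ l ∈ Finset.Icc 1 (D ^ 4), G₁ l / l) +
            δ ^ 2 * ∑ l ∈ Finset.Icc 1 (D ^ 4), G₂ l / l := by
          rw [Finset.sum_add_distrib, Finset.mul_sum, Finset.mul_sum]
      _ ≤ 2 * δ * (majorantConst 4 4 * (4 * ell D) ^ 4) + δ ^ 2 * (majorantConst 8 6 * (4 * ell D) ^ 8) :=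
          add_le_add (mul_le_mul_of_nonneg_left h1 (by positivity))
            (mul_le_mul_of_nonneg_left h2 (by positivity))
  -- assemble
  change ‖frake 1 * (∑ l ∈ Finset.Ico 1 (D ^ 4), nu χ l / (l : ℂ) * W l) -
      frake 1 * ∑ l ∈ Finset.Ico 1 (D ^ 4), nu χ l ^ 2 / (l : ℂ)‖ ≤ ε
  rw [hdiff, norm_mul]
  have hS : ‖∑ l ∈ Finset.Ico 1 (D ^ 4), nu χ l / (l : ℂ) * (W l - nu χ l)‖ ≤
      2 * δ * (majorantConst 4 4 * (4 * ell D) ^ 4) + δ ^ 2 * (majorantConst 8 6 * (4 * ell D) ^ 8) := by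
    refine (norm_sum_le _ _).trans (le_trans (Finset.sum_le_sum fun l hl => ?_) hsumR)
    rw [norm_mul, norm_div, Complex.norm_natCast]
    exact mul_le_mul_of_nonneg_left (hR l hl) (div_nonneg (norm_nonneg _) (Nat.cast_nonneg l))
  have hℓ48 : (ell D ^ 8)⁻¹ ≤ (ell D ^ 4)⁻¹ :=
    inv_anti₀ (by positivity) (pow_le_pow_right₀ hℓ1 (by norm_num))
  calc ‖frake 1‖ * ‖∑ l ∈ Finset.Ico 1 (D ^ 4), nu χ l / (l : ℂ) * (W l - nu χ l)‖
      ≤ ‖frake 1‖ * (2 * δ * (majorantConst 4 4 * (4 * ell D) ^ 4) +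
          δ ^ 2 * (majorantConst 8 6 * (4 * ell D) ^ 8)) := mul_le_mul_of_nonneg_left hS (norm_nonneg _)
    _ = ‖frake 1‖ * (42 * Real.pi * 4 ^ 4 * majorantConst 4 4 * (ell D ^ 4)⁻¹ +
          441 * Real.pi ^ 2 * 4 ^ 8 * majorantConst 8 6 * (ell D ^ 8)⁻¹) := by
        rw [hδ, hαℓ]
        field_simp
        ring
    _ ≤ ‖frake 1‖ * (42 * Real.pi * 4 ^ 4 * majorantConst 4 4 * (ell D ^ 4)⁻¹ +
          441 * Real.pi ^ 2 * 4 ^ 8 * majorantConst 8 6 * (ell D ^ 4)⁻¹) := by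
        have hM : 0 ≤ 441 * Real.pi ^ 2 * 4 ^ 8 * majorantConst 8 6 :=
          mul_nonneg (by positivity) (majorantConst_pos 8 6).le
        gcongr
    _ = K / ell D ^ 4 := by rw [hK]; field_simp
    _ ≤ ε := hKε

/-- **§17.u025 is a THEOREM** (DAG `Z22:§17.u025`): "the right side [of u024] is equal to
`𝔢₁Σ_{l<D⁴}ν(l)²/l + o(1) = 𝔢₁𝔞 + o(1)`" — the first equality by `step17_hW_holds`, the second by
Lemma 17.1 (`appBLemma171_holds`), composed by the tree's `step17_u025_of`.
[cite: Zhang2022LandauSiegel, §17 u025 p.98] -/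
theorem step17_u025_holds (c' : ℝ) : Step17_u025 c' :=
  step17_u025_of (step17_hW_holds c')

variable (c' : ℝ) in
/-- `Step17_u025` — `_holds` alias of `step17_u025_holds` above under the fact's exact name, stated under the
prover's own binders as section variables (appended 2026-08-28, D-0026 bookkeeping: the proof term is the
existing theorem of this file; no statement, definition or attribute is edited; no new named fact; the
ledger's debt table listed the fact unproved). [cite: Zhang2022LandauSiegel, §17 u025 p.98] -/
theorem _root_.Literature.NumberTheory.LFunctions.Zhang2022.Typed.Section17.Step17_u025_holds :
    _root_.Literature.NumberTheory.LFunctions.Zhang2022.Typed.Section17.Step17_u025 c' :=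
  _root_.Literature.NumberTheory.LFunctions.Zhang2022.Phi3Eval.step17_u025_holds (c' := c')

end Assembly

end Literature.NumberTheory.LFunctions.Zhang2022.Phi3Eval
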